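import Literature.MathematicalPhysics.QuantumFieldTheory.Balaban1983to89.HaarDensityUnitaryGlobal

/-!
# `Balaban1983to89.HaarDensityUnitaryGlobalPi` — [Balaban1985UV3] (13) → (18) «∫dU′↾_{Ω₁} … dU′ = σ(A′)dA′» for `U(N)`,
# GLOBALLY and over a FINITE BOND SET: the exponential chart is MEASURE-PRESERVING from `σ₀ · Π_{j,k} sinc((θ_j − θ_k)/2) dA
# |_{‖A‖<π}` to the WHOLE Haar measure of `U(N)`, hence the bondwise chart `(A_b)_b ↦ (e^{A_b})_b` is measure-preserving
# from the product of these measures to the product Haar measure `⊗_b dU(b)` — no windows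

statement-level skeleton of published theorems with citation tags; proofs where landed; nothing here is a claim
about the Yang–Mills mass gap

Mega-formalization `lit-balaban` (HOME `run/shared/lean/pub/lit-balaban/`), unit `lit-balaban-p28` gen 13 (free-target
protocol G.5-34(d), TAKING 2026-08-23T00:37Z).  File 6, rider to `HaarDensityUnitaryGlobal` (p346986: `μ = σ₀ • exp_*(|det
jac| dη|_{‖A‖<π})` on `U(N)`).  p24's `HaarExpChartPi` (p321689 lineage) proved the many-bond assembly (13) → (18) for every
closed `G ≤ U(N)` on the product of small WINDOWS `N_e^β` with an existential `σ₀`; r07's `B10Eq18SigmaSU2Haar` §8 did it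
globally for `SU(2)` in Pauli letters.  Here: `U(N)`, globally (the product of the WHOLE Haar measures), `σ₀` pinned.
SKELETON rows served (SUPPORT cells only, no head change): B10.Eq13 / B10.Eq18 / B10.Eq21 / E18 (owner r07), B13.Eq1.37
(r10), B12.Eq2.10–2.12 (r09/r20).

CITATION HEADER.  [Balaban1985UV3] T. Bałaban, CMP **102** (1985) 255–275, p. 260: *«To write the integrals (13) in terms
of the variables A′ we express the Haar measure dU′ as dU′ = σ(A′)dA′ = σ₀ σ/σ₀ (A′)dA′, σ₀ = σ(0)»* — (13) integrates
over `∫dU′↾_{Ω₁}`, the product of the one-bond Haar measures over the bonds of `Ω₁`, and (18) is the resulting integral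
`∫dA′↾_{Ω₁} … exp[Σ_b log σ/σ₀(A′(b) − …)]`.  [Helgason2000] Ch. I §1 Thm. 1.14 (13) p. 96.

WHAT IS PROVED (theorems; one definition with body — the one-bond coordinate measure `coordMeasure η μ =
σ₀ • (Π sinc) dη|_{‖A‖<π}` as an honest `ℝ≥0`-scaled finite measure; 0 named facts, 0 sorry).
* §1 `lintegral_jacDensity_ball_pi_ne_top` / `_ne_zero`, `sigma0` (`σ₀ := (μ(U(N))/∫_{‖A‖<π}|det jac| dη).toNNReal ≠ 0`),
  `coordMeasure`, `isFiniteMeasure_coordMeasure`, **`map_expChart_coordMeasure`: `Θ_*(coordMeasure η μ) = μ`** and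
  **`measurePreserving_expChart_unitaryGroup`** — the chart is measure-preserving from `(𝔲(N), σ₀·|det jac|·dη|_{‖A‖<π})`
  to `(U(N), μ)`, the WHOLE Haar measure (file 2's `haar_unitaryGroup_eq_smul_chartMeasureOn` + `windowConst_unitaryGroup_eq`).
* §2 **`measurePreserving_pi_expChart_unitaryGroup`**: for a finite bond set `β`, `(A_b)_b ↦ (e^{A_b})_b` is
  measure-preserving from `⊗_b coordMeasure` to the product Haar measure `⊗_b μ` on `U(N)^β` (Mathlib `measurePreserving_pi`);
  **`lintegral_pi_haar_unitaryGroup_eq`**: `∫_{U(N)^β} F(U) Π_b dμ(U_b) = ∫ F((e^{A_b})_b) d(⊗_b σ₀·|det jac A_b|·dη(A_b)|_{‖A_b‖<π})`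
  for every measurable `F ≥ 0` — «∫dU′↾_{Ω₁}» → «∫dA′↾_{Ω₁} Π_b σ(A′(b))», globally; `coordMeasure_eq_withDensity_prod_sinc`
  writes the density as gen 11's explicit `Π_j Π_k sinc((θ_j − θ_k)/2)`.

HONEST SCOPE.  (i) Only the change of variables of the product Haar measure is asserted; the δ-functions, `D̃`,
characteristic functions and the action of (13)/(18) are untouched (as in r07's §8 and p24's file).  (ii) `U(N)` only
(full measure of the chart image, file 2); for `SU(N)`, `N ≥ 3`, and general closed `G` only the window/big-window versions
exist (p24, file 4).  (iii) `σ₀` identified (`μ(U(N))/∫Πsinc`), not evaluated in closed form.  (iv) Nothing re-proved.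
-/

noncomputable section

open NormedSpace Set Function Filter Topology MeasureTheory Complex
open scoped ENNReal NNReal Matrix.Norms.L2Operator

namespace Literature.MathematicalPhysics.QuantumFieldTheory.Balaban1983to89.HaarDensityUnitaryGlobal

open HaarExponentialChart HaarExponentialChart.IsChartRep
open HaarDensityUnitaryChart (conjTranspose_eq_neg_of_mem_unitaryLogChart jacDensity_unitaryLogChart_eq)
open HaarDensityUnitaryExplicit (isHermitian_neg_I_smul)

variable {n : Type*} [Fintype n] [DecidableEq n]
variable [MeasurableSpace (unitaryLogChart n).lie] [BorelSpace (unitaryLogChart n).lie]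
  (η : Measure (unitaryLogChart n).lie) [η.IsAddHaarMeasure]
  (μ : Measure (Matrix.unitaryGroup n ℂ)) [μ.IsHaarMeasure]

/-! ## §1 The one-bond coordinate measure `σ₀ · |det jac| · dη|_{‖A‖<π}` and the measure-preserving chart -/

include μ in
/-- `0 < ∫_{‖A‖<π} |det jac| dη < ∞` (file 1's `haar_univ_eq_of_null` for `U(N)`, read through any Haar measure `μ`).
[cite: Helgason2000, Ch. I §1 Thm. 1.14 (13) p. 96] -/
theorem lintegral_jacDensity_ball_pi_ne_zero_and_ne_top :
    ∫⁻ X in Metric.ball 0 Real.pi, jacDensity (lie_adStable_unitaryGroup (n := n)) X ∂η ≠ 0 ∧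
      ∫⁻ X in Metric.ball 0 Real.pi, jacDensity (lie_adStable_unitaryGroup (n := n)) X ∂η ≠ ∞ :=
  ((isChartRep_unitaryGroup (n := n)).haar_univ_eq_of_null (lie_adStable_unitaryGroup (n := n)) η μ
    IsChartRep.chartRadius_pos le_rfl measurableSet_ball injOn_expChart_ball_pi (haar_compl_image_ball_pi_eq_zero μ)).2

/-- PRINT'S CONSTANT AS A NUMBER: `σ₀ := (μ(U(N)) / ∫_{‖A‖<π} |det jac| dη).toNNReal`.
[cite: Balaban1985UV3, p. 260] -/
def sigma0 (η : Measure (unitaryLogChart n).lie) (μ : Measure (Matrix.unitaryGroup n ℂ)) : ℝ≥0 :=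
  (μ Set.univ / ∫⁻ X in Metric.ball 0 Real.pi, jacDensity (lie_adStable_unitaryGroup (n := n)) X ∂η).toNNReal

/-- `(σ₀ : ℝ≥0∞) = μ(U(N)) / ∫_{‖A‖<π} |det jac| dη` (the quotient is finite). [cite: Balaban1985UV3, p. 260] -/
theorem coe_sigma0 :
    (sigma0 η μ : ℝ≥0∞) = μ Set.univ / ∫⁻ X in Metric.ball 0 Real.pi, jacDensity (lie_adStable_unitaryGroup (n := n)) X ∂η :=
  ENNReal.coe_toNNReal (ENNReal.div_ne_top (isCompact_univ.measure_lt_top (μ := μ)).ne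
    (lintegral_jacDensity_ball_pi_ne_zero_and_ne_top η μ).1)

/-- `σ₀ ≠ 0`. [cite: Balaban1985UV3, p. 260] -/
theorem sigma0_ne_zero : sigma0 η μ ≠ 0 := by
  intro h
  have h' := congrArg (fun x : ℝ≥0 => (x : ℝ≥0∞)) h
  simp only [coe_sigma0, ENNReal.coe_zero] at h'
  rw [ENNReal.div_eq_zero_iff] at h'
  rcases h' with h' | h'
  · exact isOpen_univ.measure_ne_zero μ Set.univ_nonempty h'
  · exact (lintegral_jacDensity_ball_pi_ne_zero_and_ne_top η μ).2 h'

/-- THE ONE-BOND COORDINATE MEASURE `σ₀ · |det jac A| · dη(A)|_{‖A‖<π}` on `𝔲(N)` (print's `σ(A′)dA′ = σ₀ (σ/σ₀)(A′)dA′`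
on the maximal chart domain). [cite: Balaban1985UV3, p. 260] -/
def coordMeasure (η : Measure (unitaryLogChart n).lie) (μ : Measure (Matrix.unitaryGroup n ℂ)) :
    Measure (unitaryLogChart n).lie :=
  sigma0 η μ • (η.restrict (Metric.ball 0 Real.pi)).withDensity (jacDensity (lie_adStable_unitaryGroup (n := n)))

/-- The coordinate measure is finite (`∫_{‖A‖<π}|det jac| dη < ∞`). [cite: Balaban1985UV3, p. 260] -/
instance isFiniteMeasure_coordMeasure : IsFiniteMeasure (coordMeasure η μ) := by
  unfold coordMeasure
  haveI : IsFiniteMeasure ((η.restrict (Metric.ball 0 Real.pi)).withDensity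
      (jacDensity (lie_adStable_unitaryGroup (n := n)))) :=
    isFiniteMeasure_withDensity (lintegral_jacDensity_ball_pi_ne_zero_and_ne_top η μ).2
  infer_instance

omit [BorelSpace (unitaryLogChart n).lie] [η.IsAddHaarMeasure] [μ.IsHaarMeasure] in
/-- The density written explicitly: `coordMeasure = σ₀ • (Π_j Π_k sinc((θ_j − θ_k)/2)) dη|_{‖A‖<π}` (gen 11's
`jacDensity_unitaryLogChart_eq`). [cite: Balaban1985UV3, p. 260] -/
theorem coordMeasure_eq_withDensity_prod_sinc :
    coordMeasure η μ = sigma0 η μ • (η.restrict (Metric.ball 0 Real.pi)).withDensity (fun A => ENNReal.ofReal (∏ j, ∏ k,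
      Real.sinc (((isHermitian_neg_I_smul (conjTranspose_eq_neg_of_mem_unitaryLogChart A)).eigenvalues j -
        (isHermitian_neg_I_smul (conjTranspose_eq_neg_of_mem_unitaryLogChart A)).eigenvalues k) / 2))) := by
  unfold coordMeasure
  congr 2
  funext A
  exact jacDensity_unitaryLogChart_eq A

/-- **`Θ_*(σ₀ · |det jac| · dη|_{‖A‖<π}) = μ`**: the push-forward of the coordinate measure under the exponential chart IS
the (whole) Haar measure of `U(N)`. [cite: Balaban1985UV3, p. 260] [cite: Helgason2000, Ch. I §1 Thm. 1.14 (13) p. 96] -/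
theorem map_expChart_coordMeasure :
    (coordMeasure η μ).map (isChartRep_unitaryGroup (n := n)).expChart = μ := by
  have hμ := haar_unitaryGroup_eq_smul_chartMeasureOn η μ IsChartRep.chartRadius_pos le_rfl
  rw [windowConst_unitaryGroup_eq η μ IsChartRep.chartRadius_pos le_rfl, ← coe_sigma0] at hμ
  conv_rhs => rw [hμ]
  rw [coordMeasure, Measure.map_smul, ENNReal.smul_def]
  rfl

/-- **THE EXPONENTIAL CHART OF `U(N)` IS MEASURE-PRESERVING from `(𝔲(N), σ₀·|det jac|·dη|_{‖A‖<π})` to `(U(N), μ)`** —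
«dU′ = σ(A′)dA′» as a global statement. [cite: Balaban1985UV3, p. 260] [cite: Helgason2000, Ch. I §1 Thm. 1.14 (13) p. 96] -/
theorem measurePreserving_expChart_unitaryGroup :
    MeasurePreserving (isChartRep_unitaryGroup (n := n)).expChart (coordMeasure η μ) μ :=
  ⟨(isChartRep_unitaryGroup (n := n)).measurable_expChart, map_expChart_coordMeasure η μ⟩

/-! ## §2 (13) → (18) over a finite bond set: the product Haar measure in canonical coordinates -/

variable {β : Type*} [Fintype β]

/-- **«∫dU′↾_{Ω₁}» → «∫dA′↾_{Ω₁} Π_b σ(A′(b))dA′(b)» FOR `U(N)`, GLOBALLY**: the bondwise chart `(A_b)_b ↦ (e^{A_b})_b` is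
MEASURE-PRESERVING from `⊗_b (σ₀·|det jac|·dη|_{‖A‖<π})` to the product Haar measure `⊗_b μ` on `U(N)^β` (Mathlib
`measurePreserving_pi`). [cite: Balaban1985UV3, p. 260] [cite: Helgason2000, Ch. I §1 Thm. 1.14 (13) p. 96] -/
theorem measurePreserving_pi_expChart_unitaryGroup :
    MeasurePreserving (fun A : β → (unitaryLogChart n).lie => fun b => (isChartRep_unitaryGroup (n := n)).expChart (A b))
      (Measure.pi fun _ : β => coordMeasure η μ) (Measure.pi fun _ : β => μ) :=
  measurePreserving_pi (fun _ : β => coordMeasure η μ) (fun _ : β => μ)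
    fun _ => measurePreserving_expChart_unitaryGroup η μ

/-- **THE PRODUCT HAAR INTEGRAL IN CANONICAL COORDINATES**: for every measurable `F ≥ 0` on `U(N)^β`,
`∫ F d(⊗_b μ) = ∫ F((e^{A_b})_b) d(⊗_b σ₀·|det jac A_b|·dη(A_b)|_{‖A_b‖<π})`.
[cite: Balaban1985UV3, p. 260] [cite: Helgason2000, Ch. I §1 Thm. 1.14 (13) p. 96] -/
theorem lintegral_pi_haar_unitaryGroup_eq {F : (β → Matrix.unitaryGroup n ℂ) → ℝ≥0∞} (hF : Measurable F) :
    ∫⁻ U, F U ∂(Measure.pi fun _ : β => μ) =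
      ∫⁻ A, F (fun b => (isChartRep_unitaryGroup (n := n)).expChart (A b)) ∂(Measure.pi fun _ : β => coordMeasure η μ) := by
  rw [← (measurePreserving_pi_expChart_unitaryGroup (β := β) η μ).map_eq,
    lintegral_map hF (measurePreserving_pi_expChart_unitaryGroup (β := β) η μ).measurable]

/-- The same for the measure of Borel subsets of `U(N)^β`: `(⊗_b μ)(B) = (⊗_b coordMeasure)({A : (e^{A_b})_b ∈ B})`.
[cite: Balaban1985UV3, p. 260] -/
theorem pi_haar_unitaryGroup_apply_eq {B : Set (β → Matrix.unitaryGroup n ℂ)} (hB : MeasurableSet B) :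
    (Measure.pi fun _ : β => μ) B =
      (Measure.pi fun _ : β => coordMeasure η μ)
        ((fun A : β → (unitaryLogChart n).lie => fun b => (isChartRep_unitaryGroup (n := n)).expChart (A b)) ⁻¹' B) := by
  rw [← (measurePreserving_pi_expChart_unitaryGroup (β := β) η μ).map_eq,
    Measure.map_apply (measurePreserving_pi_expChart_unitaryGroup (β := β) η μ).measurable hB]

end Literature.MathematicalPhysics.QuantumFieldTheory.Balaban1983to89.HaarDensityUnitaryGlobal
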